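import Mathlib
import Literature.Geometry.Symplectic.SteinDomain
import Literature.Geometry.Symplectic.SteinBoundaryContact
import Literature.Topology.FourManifolds.CorkTwist

/-!
# Sketch — crux-ideate stmt-SmoothPoincare4-10508 (AcyclicBisectionExists), ideator 3, round 1

First lemmas of two idea cards:
* `ModpBraidOrbits` — card `modp-braid-orbits`: signed homological Hurwitz moves, reduction mod `p`,
  orbit lifting, irreducibility of Bf-connected transvection sets, and the finite-group TARGET.
* `CorkShadow` — card `cork-shadow-transport`: Stein shadows `S(C)` of a boundary-marked compact
  4-manifold, push-forward by a boundary diffeomorphism, and the transfer lemma across a cork twist.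
-/

noncomputable section

open scoped Manifold ContDiff Topology

namespace Summit.SmoothPoincare4.SmoothPoincare4.Cruxes.AcyclicBisectionExists

/-! ## Card `modp-braid-orbits` -/
namespace ModpBraidOrbits

section General

variable {R : Type*} [CommRing R] {V : Type*} [AddCommGroup V] [Module R V]

/-- The sign of a letter as a ring element (`true` = positive Dehn twist / transvection). -/
def sgn (b : Bool) : R := if b then 1 else -1

/-- One signed homological Hurwitz move on a word of signed classes, for the pairing `Bf`
(the intersection form on `H₁(F)`): the braid generator
`(a,ε)(b,ε') ↦ (b + ε·ω(a,b)·a, ε')(a,ε)`  (from `t_a^ε t_b^ε' = t^{ε'}_{t_a^ε b} t_a^ε`)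
or its inverse `(a,ε)(b,ε') ↦ (b,ε')(a − ε'·ω(b,a)·b, ε)`. Signs travel with the letters. -/
def HurwitzStep (Bf : V →ₗ[R] V →ₗ[R] R) (l l' : List (V × Bool)) : Prop :=
  ∃ (pre suf : List (V × Bool)) (a b : V × Bool), l = pre ++ a :: b :: suf ∧
    (l' = pre ++ (b.1 + (sgn a.2 * Bf a.1 b.1) • a.1, b.2) :: a :: suf ∨
     l' = pre ++ b :: (a.1 - (sgn b.2 * Bf b.1 a.1) • b.1, a.2) :: suf)

/-- The Hurwitz orbit relation (reflexive–transitive closure of signed Hurwitz moves). -/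
def HurwitzOrbit (Bf : V →ₗ[R] V →ₗ[R] R) : List (V × Bool) → List (V × Bool) → Prop :=
  Relation.ReflTransGen (HurwitzStep Bf)

/-- The classes carried by the letters of a given sign. -/
def classesOfSign (l : List (V × Bool)) (s : Bool) : Set V := {v | ∃ x ∈ l, x.2 = s ∧ x.1 = v}

variable (R) in
/-- SORTED (all positive letters first) and BI-SPANNING (the positive classes span `V` and so do the
negative ones). For a balanced word of length `2·rank V` this says: both halves are bases. -/
def SortedBiSpanning (l : List (V × Bool)) : Prop :=
  (∃ P N : List (V × Bool), l = P ++ N ∧ (∀ x ∈ P, x.2 = true) ∧ (∀ x ∈ N, x.2 = false)) ∧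
    Submodule.span R (classesOfSign l true) = ⊤ ∧ Submodule.span R (classesOfSign l false) = ⊤

/-- The signed symplectic transvection of a letter: `x ↦ x + ε·ω(v,x)·v`. -/
def transvection (Bf : V →ₗ[R] V →ₗ[R] R) (x : V × Bool) : Module.End R V :=
  LinearMap.id + (sgn x.2 : R) • (Bf x.1).smulRight x.1

/-- The monodromy (product of the signed transvections, first letter outermost). -/
def wordProduct (Bf : V →ₗ[R] V →ₗ[R] R) (l : List (V × Bool)) : Module.End R V :=
  (l.map (transvection Bf)).prod

/-- Bf-connectedness of a set of classes: no proper non-empty subset is Bf-orthogonal to its complement. -/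
def OmegaConnected (Bf : V →ₗ[R] V →ₗ[R] R) (S : Set V) : Prop :=
  ∀ T ⊆ S, T.Nonempty → T ≠ S → ∃ v ∈ T, ∃ w ∈ S \ T, Bf v w ≠ 0

end General

section Reduction

variable {R S : Type*} [CommRing R] [CommRing S] {V W : Type*} [AddCommGroup V] [Module R V]
  [AddCommGroup W] [Module S W]

/-- A reduction datum: a ring hom `f : R → S` (think `ℤ → ZMod p`), an `f`-semilinear map
`φ : V → W` (think `H₁(F;ℤ) → H₁(F;𝔽_p)`) and pairings compatible with it. -/
structure ReductionDatum (f : R →+* S) (Bf : V →ₗ[R] V →ₗ[R] R) (Bf' : W →ₗ[S] W →ₗ[S] S) where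
  /-- the reduction of classes -/
  φ : V →ₛₗ[f] W
  /-- compatibility of the pairings -/
  compat : ∀ a b, Bf' (φ a) (φ b) = f (Bf a b)

variable {f : R →+* S} {Bf : V →ₗ[R] V →ₗ[R] R} {Bf' : W →ₗ[S] W →ₗ[S] S}

/-- Reduction of a signed word. -/
def ReductionDatum.mapWord (D : ReductionDatum f Bf Bf') (l : List (V × Bool)) : List (W × Bool) :=
  l.map fun x => (D.φ x.1, x.2)

/-- EQUIVARIANCE: a Hurwitz move upstairs reduces to a Hurwitz move downstairs. -/
theorem ReductionDatum.step_map (D : ReductionDatum f Bf Bf') {l l' : List (V × Bool)}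
    (h : HurwitzStep Bf l l') : HurwitzStep Bf' (D.mapWord l) (D.mapWord l') := by
  sorry

/-- ORBIT LIFTING (the mod-`p` trick): every element of the Hurwitz orbit of the reduced word is the
reduction of an element of the Hurwitz orbit of the word itself (the same braid acts on both). -/
theorem ReductionDatum.orbit_lift (D : ReductionDatum f Bf Bf') (l : List (V × Bool)) (m' : List (W × Bool))
    (h : HurwitzOrbit Bf' (D.mapWord l) m') : ∃ l', HurwitzOrbit Bf l l' ∧ D.mapWord l' = m' := by
  sorry

/-- CONSEQUENCE used by the card: if the reduced orbit contains a sorted bi-spanning word then the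
integral orbit contains a word whose reduction is sorted bi-spanning (hence, for `V = ℤ^{2g} → 𝔽_p^{2g}`,
whose positive and negative classes are ℚ-bases: a determinant that is a unit mod `p` is non-zero). -/
theorem ReductionDatum.exists_lift_of_sortedBiSpanning (D : ReductionDatum f Bf Bf') (l : List (V × Bool))
    (h : ∃ m', HurwitzOrbit Bf' (D.mapWord l) m' ∧ SortedBiSpanning S m') :
    ∃ l', HurwitzOrbit Bf l l' ∧ SortedBiSpanning S (D.mapWord l') := by
  obtain ⟨m', hm', hsb⟩ := h
  obtain ⟨l', hl', rfl⟩ := D.orbit_lift l m' hm'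
  exact ⟨l', hl', hsb⟩

end Reduction

section FiniteField

variable {K : Type*} [Field K] {V : Type*} [AddCommGroup V] [Module K V]

/-- IRREDUCIBILITY (McLaughlin's hypothesis): if the classes `S` span `V`, are Bf-connected and `Bf` is
non-degenerate, then no proper non-zero subspace is invariant under all transvections along `S`.
(Proof sketch: `T_v x − x = ω(v,x)v` puts some `v ∈ S` in the subspace, connectedness propagates.) -/
theorem no_invariant_subspace (Bf : V →ₗ[K] V →ₗ[K] K) (hnd : ∀ x : V, (∀ y, Bf y x = 0) → x = 0)
    (S : Set V) (hspan : Submodule.span K S = ⊤) (hconn : OmegaConnected Bf S)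
    (M : Submodule K V) (hM : M ≠ ⊥) (hinv : ∀ v ∈ S, ∀ x ∈ M, x + (Bf v x) • v ∈ M) : M = ⊤ := by
  sorry

/-- The standard symplectic pairing on `K^g ⊕ K^g` (block matrix `[[0, 1], [-1, 0]]`). -/
def stdSymp (g : ℕ) : (Fin g ⊕ Fin g → K) →ₗ[K] (Fin g ⊕ Fin g → K) →ₗ[K] K :=
  Matrix.toLinearMap₂' K (Matrix.fromBlocks 0 (1 : Matrix (Fin g) (Fin g) K) (-1) 0)

/-- TARGET (card `modp-braid-orbits`, crux K1 — the finite-group engine). Over `𝔽_p`, `p` an odd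
prime: a balanced signed word of `4g` non-zero vectors of the standard symplectic space `𝔽_p^{2g}`,
spanning, Bf-connected, with trivial signed monodromy, has a SORTED BI-SPANNING word in its Hurwitz
orbit. Intended proof: `no_invariant_subspace` + McLaughlin (irreducible transvection groups in odd
characteristic are `Sp(2g,p)`) + braid-orbit transitivity for transvection tuples (Clebsch–Hurwitz /
Conway–Parker type). Toy evidence: kit jobs j006443, j006445 (`g = 2`, `p = 3`). -/
theorem target_sortedBiSpanning_modp (p : ℕ) [Fact p.Prime] (hp : p ≠ 2) (g : ℕ) (hg : 1 ≤ g)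
    (l : List ((Fin g ⊕ Fin g → ZMod p) × Bool))
    (hlen : l.length = 4 * g) (hbal : (l.filter (·.2)).length = 2 * g)
    (hne : ∀ x ∈ l, x.1 ≠ 0)
    (hspan : Submodule.span (ZMod p) {v | ∃ x ∈ l, x.1 = v} = ⊤)
    (hconn : OmegaConnected (stdSymp (K := ZMod p) g) {v | ∃ x ∈ l, x.1 = v})
    (hprod : wordProduct (stdSymp (K := ZMod p) g) l = 1) :
    ∃ l', HurwitzOrbit (stdSymp (K := ZMod p) g) l l' ∧ SortedBiSpanning (ZMod p) l' := by
  sorry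

end FiniteField

end ModpBraidOrbits

/-! ## Card `cork-shadow-transport` -/
namespace CorkShadow

open Literature.Geometry.Symplectic Literature.Topology.FourManifolds

/-- Local notation for the model spaces. -/
local notation "E3" => EuclideanSpace ℝ (Fin 3)
local notation "E4" => EuclideanSpace ℝ (Fin 4)

variable {C : Type} [TopologicalSpace C] [T2Space C] [SecondCountableTopology C]
  [ChartedSpace (EuclideanHalfSpace 4) C] [IsManifold (𝓡∂ 4) ∞ C] [CompactSpace C]
variable {W : Type} [TopologicalSpace W] [T2Space W] [SecondCountableTopology W]
  [ChartedSpace (EuclideanHalfSpace 4) W] [IsManifold (𝓡∂ 4) ∞ W] [CompactSpace W]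

/-- The field of complex tangencies of a Stein structure, pulled back to the abstract boundary
3-manifold `b.carrier` of the boundary datum `b` (a plane field on `∂C`). -/
def boundaryPlanes (b : BoundaryData (𝓡∂ 4) C (𝓡 3)) (S : SteinStructure C) :
    b.carrier → Submodule ℝ E3 :=
  fun z => (contactPlane S.J (b.incl z)).comap (mfderiv (𝓡 3) (𝓡∂ 4) b.incl z).toLinearMap

/-- The STEIN SHADOW `S(C)` of the boundary-marked compact 4-manifold `C`: the plane fields on `∂C`
induced by Stein structures on the smooth manifold `C` (pointwise form; isotopies are absorbed by
diffeomorphisms of `C` isotopic to the identity, so nothing is lost). Finite modulo isotopy by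
Colin–Giroux–Honda + Gay (zero Giroux torsion). -/
def SteinShadow (b : BoundaryData (𝓡∂ 4) C (𝓡 3)) : Set (b.carrier → Submodule ℝ E3) :=
  {ξ | ∃ S : SteinStructure C, boundaryPlanes b S = ξ}

/-- Push-forward of a plane field on `∂C` along a self-diffeomorphism `τ` of `∂C`. -/
def pushPlanes (b : BoundaryData (𝓡∂ 4) C (𝓡 3)) (τ : b.carrier ≃ₘ⟮𝓡 3, 𝓡 3⟯ b.carrier)
    (ξ : b.carrier → Submodule ℝ E3) : b.carrier → Submodule ℝ E3 :=
  fun z => (ξ (τ.symm z)).map (mfderiv (𝓡 3) (𝓡 3) τ (τ.symm z)).toLinearMap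

/-- The STRONG shadow hypothesis for `(C, τ)`: `τ_* S(C) ⊆ S(C)` (Stein-induced plane fields transport
across the cork map). The card only needs it at one point of `S(C)`. -/
def ShadowInvariant (b : BoundaryData (𝓡∂ 4) C (𝓡 3)) (τ : b.carrier ≃ₘ⟮𝓡 3, 𝓡 3⟯ b.carrier) :
    Prop :=
  ∀ ξ ∈ SteinShadow b, pushPlanes b τ ξ ∈ SteinShadow b

/-- A MATCHED Stein pair across a boundary identification `φ : ∂C ≅ ∂W`: the complex tangencies of
`S_C`, pushed along `φ`, are the complex tangencies of `S_W` — the common-contact-seam condition of the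
crux for the glued manifold `C ∪_φ W̄`. -/
def Matched (bC : BoundaryData (𝓡∂ 4) C (𝓡 3)) (bW : BoundaryData (𝓡∂ 4) W (𝓡 3))
    (φ : bC.carrier ≃ₘ⟮𝓡 3, 𝓡 3⟯ bW.carrier) (SC : SteinStructure C) (SW : SteinStructure W) : Prop :=
  ∀ z, (boundaryPlanes bC SC z).map (mfderiv (𝓡 3) (𝓡 3) φ z).toLinearMap = boundaryPlanes bW SW (φ z)

/-- FIRST LEMMA of card `cork-shadow-transport` (transfer across a cork twist). If `X = C ∪_φ W`
carries a matched Stein pair `(S_C, S_W)` and the pulled-back plane field `τ^* ξ_{S_C}` is again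
Stein-induced on `C`, then the cork twist `X' = C ∪_{φ ∘ τ} W` carries a matched Stein pair with the
same `S_W`. (Chain rule; with Matveyev–AM Thm 6 and the contractibility of both pieces this is the
reduction "AcyclicBisectionExists(Σ) ⇐ matched cork presentation of S⁴ + one shadow membership".) -/
theorem matched_after_corkTwist (bC : BoundaryData (𝓡∂ 4) C (𝓡 3)) (bW : BoundaryData (𝓡∂ 4) W (𝓡 3))
    (φ : bC.carrier ≃ₘ⟮𝓡 3, 𝓡 3⟯ bW.carrier) (τ : bC.carrier ≃ₘ⟮𝓡 3, 𝓡 3⟯ bC.carrier)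
    (SC : SteinStructure C) (SW : SteinStructure W) (h : Matched bC bW φ SC SW)
    (hτ : pushPlanes bC τ.symm (boundaryPlanes bC SC) ∈ SteinShadow bC) :
    ∃ SC' : SteinStructure C, Matched bC bW (τ.trans φ) SC' SW := by
  sorry

/-- PERIODICITY (pigeonhole form used by the card for infinite-order cork twists): a permutation of a
finite set returns every point to itself after a positive number of iterations. Applied to `f_*` acting
on the finite set of isotopy classes of Stein-fillable contact structures on `∂C` (CGH finiteness + Gay),
it gives matched Stein pairs on `C ∪_{φ ∘ f^{km}} W` for all `k`. -/
theorem periodic_point {α : Type*} [Finite α] (f : Equiv.Perm α) (x : α) :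
    ∃ m : ℕ, 0 < m ∧ (f ^ m) x = x := by
  refine ⟨orderOf f, orderOf_pos f, ?_⟩
  rw [pow_orderOf_eq_one]; rfl

end CorkShadow

end Summit.SmoothPoincare4.SmoothPoincare4.Cruxes.AcyclicBisectionExists
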